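import Literature.NumberTheory.Automorphic.CDTTheorem722
import Literature.NumberTheory.Automorphic.FreitasLeHungSiksekLifting
import Literature.NumberTheory.EllipticCurves.MatarNekovar2019.IrreducibleOverQuadraticFieldClauseThreeProofs
import Literature.NumberTheory.EllipticCurves.SzpiroOfAbcProofs
import Literature.NumberTheory.EllipticCurves.SzpiroFreyConductorProofs
import Literature.NumberTheory.EllipticCurves.PAdicGrossZagierConstantTermProofs
import Literature.NumberTheory.EllipticCurves.SerreOpenImageDeterminantProofs
import Literature.NumberTheory.GaloisRepresentations.AbsIrreducibleIndexTwo
import Literature.NumberTheory.GaloisRepresentations.ImaginaryQuadraticCyclotomicProofs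
import Literature.NumberTheory.GaloisRepresentations.ArtinRestriction
import HarnessLib

/-!
# Stub-ideation k1 (GEN 4, 2026-08-31) for `stub_liftFive` (crux stmt-ABC-11340, line `Sketch`)

Backs `STUB-IDEAS-stub_liftFive-1.md` (HOME FAMILY 1 — RECOGNISE & IMPORT).  Elaboration sanity
only: every `sorry` is a HELPER LEMMA offered to the stub prover; every sorry-free theorem is a
closer / calibration / assembly the prover can copy.  Gen 4 supersedes gen 3 (same subpath; earlier
generations are in git history).  GEN-4 DELTA: (i) **B6 is closed by citation** (the ACCEPTED
`Summit.ABC.ABC.Theorems.isModular_smul_iff`; `sorry` kept only to stay Literature-only); (ii) **B1 is RECOGNISED** as the even-rank sibling of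
the tree's `AbsIrreducibleIndexTwo` (Clifford parity ↦ cyclicity of `Gal(ℚ(ζ₅)/ℚ)`): it holds for
EVERY `ρ̄ : Γ_ℚ → GL₂(A)` — no curve, no determinant, no GAP — and is PROVED here from one group lemma
(`absIrr_comp_of_forall_index_two_le`, M) and four Galois facts about `ℚ ⊂ ℚ(√5) ⊂ ℚ(ζ₅)` (S each,
every input a named tree theorem); (iii) **L3** `not_sq_dvd_conductorNorm_freyCurve_of_odd` (Frey
curves have no vexing primes at any odd `ℓ`) is proved; (iv) Plans A/B unchanged and kernel-checked.
-/

set_option autoImplicit false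
set_option linter.dupNamespace false

noncomputable section

open scoped NumberField MatrixGroups Polynomial
open NumberField IsDedekindDomain Field Filter Polynomial Rat.HeightOneSpectrum IsDedekindDomain.HeightOneSpectrum
  Literature.NumberTheory
  Literature.NumberTheory.GaloisRepresentations Literature.NumberTheory.Automorphic
  Literature.NumberTheory.Automorphic.BCDT Literature.NumberTheory.EllipticCurves
  Literature.NumberTheory.EllipticCurves.ModularForms

namespace Summit.ABC.ABC.Cruxes.FreyModularity.StubIdeasLiftFive1

/-- VERBATIM statement of the registered stub `stub_liftFive`. -/
def LiftFive : Prop :=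
  ∀ (W : WeierstrassCurve ℚ) [W.IsElliptic] (ρ : ModPGaloisRep ℚ (ZMod 5) 2),
    W.IsTorsionGaloisRep 5 ρ → ρ.IsAbsIrreducibleOverSqrt 5 → ¬ 25 ∣ W.conductorNorm ℤ →
    ρ.IsModular → W.IsModularGaloisRepTate 5

/-! ## Plan A — the print seat SHARED with `stub_liftThree`:
Rubin, CSS 1997, Thm. B (p. 552) = Silverberg, CSS Thm. 8.7 = Diamond 1996 Thm. 5.3 applied to
`ρ_{E,p}` — ONE family in the odd prime `p`, quadratic field `ℚ(√p*)`, `p* = (-1)^{(p-1)/2} p`. -/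

/-- `p* = (-1)^{(p-1)/2} · p` (so `3* = -3`, `5* = 5`). -/
def pStar (p : ℕ) : ℚ := (-1) ^ ((p - 1) / 2) * p

/-- **Rubin 1997, Thm. B** [CSS XVI, p. 552; Silverberg CSS Thm. 8.7; Diamond 1996 Thm. 5.3]:
`p` an odd prime, `E/ℚ` elliptic with (H1) good or multiplicative reduction at `p`
(`¬ p² ∣ N_E`), (H2) `ρ̄_{E,p}` irreducible over `ℚ(√p*)`, (H3) `ρ̄_{E,p}` modular; then `E` is
modular.  Conventions as in the accepted `CDT_theorem_7_2_2`. -/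
def Rubin1997_theoremB_at (p : ℕ) [Fact p.Prime] : Prop :=
  ∀ (W : WeierstrassCurve ℚ) [W.IsElliptic] [NeZero (W.conductorNorm ℤ)]
    (ρ : ModPGaloisRep ℚ (ZMod p) 2), W.IsTorsionGaloisRep p ρ →
    ρ.IsAbsIrreducibleOverSqrt (pStar p) → ¬ p ^ 2 ∣ W.conductorNorm ℤ → ρ.IsModular → IsModular W

/-- The family over all odd primes (the form to SEAT once in Literature; `p = 3` closes
`stub_liftThree` restricted to `9 ∤ N`, `p = 5` closes `stub_liftFive`). -/
def Rubin1997_theoremB : Prop := ∀ (p : ℕ) [Fact p.Prime], p ≠ 2 → Rubin1997_theoremB_at p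

/-- **Closer A (PROVED): the seat at `p = 5` gives the stub verbatim.** -/
theorem liftFive_of_Rubin1997_theoremB_at (h : Rubin1997_theoremB_at 5) : LiftFive := by
  intro W _ ρ hρ hirr h25 hmod
  haveI : NeZero (W.conductorNorm ℤ) := ⟨(WeierstrassCurve.conductorNorm_pos_holds W).ne'⟩
  have h5 : pStar 5 = 5 := by norm_num [pStar]
  have hirr' : ρ.IsAbsIrreducibleOverSqrt (pStar 5) := by rw [h5]; exact hirr
  have h25' : ¬ 5 ^ 2 ∣ W.conductorNorm ℤ := by norm_num [h25]
  exact (h W ρ hρ hirr' h25' hmod).isModularGaloisRepTate 5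

/-- **Calibration (PROVED): the accepted umbrella `CDT_theorem_7_2_2` implies the seat at `5`** —
so the seat is the WEAKER (more verbatim) trust base. -/
theorem Rubin1997_theoremB_at_five_of_CDT (h : CDT_theorem_7_2_2) : Rubin1997_theoremB_at 5 := by
  intro W _ _ ρ hρ hirr _ hmod
  have h5 : pStar 5 = 5 := by norm_num [pStar]
  rw [h5] at hirr
  exact h W ρ hρ hirr hmod

/-! ## Plan B (gen 3, kept) — import `FLS2015_theorems3_4` (FLS Thm. 3) at `K = ℚ`, `p = 5`

No residual modularity is needed: the stub's hypotheses `ρ.IsModular` and `¬ 25 ∣ N_E` are UNUSED on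
this road.  Helpers B1' (from B1 below), B4 (S), B6 (CLOSED in gen 4), B3 (L, the one large debt). -/

/-! ### GEN 4 · B1 recognised and proved modulo one group lemma + four Galois facts

**B1 (general form).** For ANY `ρ̄ : Γ_ℚ → GL₂(A)`: `ρ̄|Γ_{ℚ(√5)}` absolutely irreducible ⇒
`ρ̄|Γ_{ℚ(ζ₅)}` absolutely irreducible.  Proof = the tree's
`Representation.isIrreducible_comp_of_index_two` (Clifford, parity case) with "odd rank" replaced by
"`Γ_ℚ/Γ_{ℚ(ζ₅)} ≅ (ℤ/5)ˣ` is CYCLIC of order `4` and `Γ_{ℚ(√5)}` is its unique index-2 overgroup":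
over a field `B`, let `U` be a `Γ_{ℚ(ζ₅)}`-stable line; the `Γ_{ℚ(ζ₅)}`-stable lines are permuted by
`Γ_ℚ` (normality); ONE such line ⇒ `U` is `Γ_ℚ`-stable; TWO ⇒ `Stab(U) ⊇ Γ_{ℚ(ζ₅)}` has index `≤ 2`,
hence contains `Γ_{ℚ(√5)}` (cyclicity); `≥ 3` ⇒ `Γ_{ℚ(ζ₅)}` acts by scalars and `Γ_{ℚ(√5)} =
Γ_{ℚ(ζ₅)} ∪ m Γ_{ℚ(ζ₅)}` fixes an eigenline of `m` over `B̄`.  Each case contradicts absolute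
irreducibility over `ℚ(√5)`. -/

/-- **B1-grp (M; the even-rank sibling of `FramedRep.IsAbsolutelyIrreducible.comp_of_index_two`,
proposed for `Literature/NumberTheory/GaloisRepresentations/AbsIrreducibleIndexTwo.lean`).**  Rank
`2`; `N = φN(HN) ⊴ G`, `N ≤ M = φM(HM)`, `[M : N] = 2`, and `M` lies in every index-2 subgroup of `G`
containing `N` (e.g. `G/N` cyclic of order `4`).  Then `ρ ∘ φM` absolutely irreducible ⇒ `ρ ∘ φN`
absolutely irreducible.  Proof: the three cases of the section docstring (number of `N`-stable lines
over `B` = 1, 2, ≥ 3), bookkeeping exactly as in `Representation.isIrreducible_comp_of_index_two`.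
[cite: Clifford1937, Thm. 1] -/
theorem absIrr_comp_of_forall_index_two_le {G HM HN : Type*} [Group G] [TopologicalSpace G]
    [Group HM] [TopologicalSpace HM] [Group HN] [TopologicalSpace HN]
    {A : Type*} [Field A] [TopologicalSpace A] (ρ : FramedRep G A 2)
    (φM : HM →ₜ* G) (φN : HN →ₜ* G) (hN : φN.toMonoidHom.range.Normal)
    (hNM : φN.toMonoidHom.range ≤ φM.toMonoidHom.range)
    (h2 : (φN.toMonoidHom.range.subgroupOf φM.toMonoidHom.range).index = 2)
    (hkey : ∀ K : Subgroup G, φN.toMonoidHom.range ≤ K → K.index = 2 → φM.toMonoidHom.range ≤ K)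
    (hM : FramedRep.IsAbsolutelyIrreducible (ρ.comp φM)) :
    FramedRep.IsAbsolutelyIrreducible (ρ.comp φN) := by
  sorry

section Galois

variable (L : Type) [Field L] [Algebra ℚ L] [IsCyclotomicExtension {5} ℚ L]
  (M : Type) [Field M] [Algebra ℚ M] [IsSplittingField ℚ M (X ^ 2 - C (5 : ℚ))]

/-- **GAL1 (S, PROVED).** `Γ_{ℚ(ζ₅)} ⊴ Γ_ℚ`: it is `{γ : χ̄₅(γ) = 1}`
(`mem_range_absGaloisRestrict_cyclotomic_iff`), the kernel of a homomorphism. [folklore] -/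
theorem range_absGaloisRestrict_cyclotomic_normal :
    (absGaloisRestrict ℚ L).toMonoidHom.range.Normal := by
  haveI : NeZero ((5 : ℕ) : ℚ) := ⟨by norm_num⟩
  refine ⟨fun n hn g => ?_⟩
  have hn' : modPCyclotomicCharacterZMod ℚ 5 n = 1 :=
    (mem_range_absGaloisRestrict_cyclotomic_iff (K := ℚ) 5 L n).mp hn
  refine (mem_range_absGaloisRestrict_cyclotomic_iff (K := ℚ) 5 L _).mpr ?_
  simp [map_mul, hn']

/-- **GAL0 (S).** For a model `M` of `ℚ(√5)`, `γ ∈ Γ_ℚ` lies in the image of `Γ_M` iff it fixes the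
tree's `√5 = WeierstrassCurve.geomSqrt 5` (`exists_mem_range_absGaloisRestrict_iff ℚ M`: the image is
the pointwise stabiliser of `e(M) = ℚ(e(√5))`, and `e(√5) = ±geomSqrt 5` by `geomSqrt_sq`).
[folklore] -/
theorem mem_range_absGaloisRestrict_sqrt_iff (γ : absoluteGaloisGroup ℚ) :
    γ ∈ (absGaloisRestrict ℚ M).toMonoidHom.range ↔
      γ • WeierstrassCurve.geomSqrt (5 : ℚ) = WeierstrassCurve.geomSqrt (5 : ℚ) := by
  sorry

/-- **GAL2 (S).** `Γ_{ℚ(ζ₅)} ≤ Γ_{ℚ(√5)}` (`√5 ∈ ℚ(ζ₅)`): `χ̄₅(γ) = 1`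
(`mem_range_absGaloisRestrict_cyclotomic_iff`) ⇒ `γ s = (χ̄₅(γ)/5) s = s` for the quadratic Gauss sum
`s`, `s² = (-1/5)·5 = 5` (`Rat.exists_gaussSum`), and `s = ± geomSqrt 5` (`geomSqrt_sq`); conclude by
GAL0. [cite: IrelandRosen1990, Prop. 6.3.2] -/
theorem range_cyclotomic_le_range_sqrt :
    (absGaloisRestrict ℚ L).toMonoidHom.range ≤
      (absGaloisRestrict ℚ M).toMonoidHom.range := by
  sorry

/-- **GAL3 (S).** `[Γ_{ℚ(√5)} : Γ_{ℚ(ζ₅)}] = 2`: indices `4 = [ℚ(ζ₅):ℚ]`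
(`IsCyclotomicExtension.finrank`, `Nat.totient 5 = 4`) and `2 = [M:ℚ]` (`X² - 5` irreducible) by
`Automorphic.isOpen_range_absGaloisRestrict_and_index`, then `Subgroup.relindex_mul_index` with GAL2.
[folklore] -/
theorem index_subgroupOf_range_sqrt_eq_two :
    ((absGaloisRestrict ℚ L).toMonoidHom.range.subgroupOf
      (absGaloisRestrict ℚ M).toMonoidHom.range).index = 2 := by
  sorry

/-- **GAL4 (S) — where cyclicity of `(ℤ/5)ˣ` enters.** An index-2 subgroup `K ⊇ Γ_{ℚ(ζ₅)}` of `Γ_ℚ`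
contains `Γ_{ℚ(√5)}`: if `γ` fixes `√5` then `(χ̄₅(γ)/5) = 1` (`Rat.exists_gaussSum`, `s ≠ 0`), so
`χ̄₅(γ) = t²`; pick `δ` with `χ̄₅(δ) = t` (`modPCyclotomicCharacterZMod_rat_surjective`); then
`δ⁻² γ ∈ Γ_{ℚ(ζ₅)} ⊆ K` and `δ² ∈ K` (`Subgroup.mul_mem_iff_of_index_two`), so `γ ∈ K`. [folklore] -/
theorem range_sqrt_le_of_index_two (K : Subgroup (absoluteGaloisGroup ℚ))
    (hK : (absGaloisRestrict ℚ L).toMonoidHom.range ≤ K) (hK2 : K.index = 2) :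
    (absGaloisRestrict ℚ M).toMonoidHom.range ≤ K := by
  sorry

end Galois

/-- **B1, general form (KERNEL-CHECKED modulo B1-grp + GAL0/2/3/4).** For every
`ρ̄ : Γ_ℚ → GL₂(A)` and every model `M` of `ℚ(√5)`: `ρ̄|Γ_M` absolutely irreducible ⇒ `ρ̄|Γ_L`
absolutely irreducible for every model `L` of `ℚ(ζ₅)`.  No curve, no determinant hypothesis.
Canonical home: `Literature/NumberTheory/GaloisRepresentations/AbsIrreducibleIndexTwo.lean`
(consumers: ABC `stub_liftFive` roads B/k2-A, BSD `Cruxes/UpperNonSurjFive/Lines/twpatch5.lean`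
`TaylorWiles W p`, Langlands `ReciprocityUpToIrreducibility/Lines/*` `TaylorWilesHypothesis`,
`Kisin2009.hypothesisFive`). [cite: Clifford1937, Thm. 1] -/
theorem absIrr_restrictField_cyclotomic_of_sqrt_five {A : Type*} [Field A] [TopologicalSpace A]
    (ρ : FramedGaloisRep ℚ A 2) (M : Type) [Field M] [Algebra ℚ M]
    [IsSplittingField ℚ M (X ^ 2 - C (5 : ℚ))]
    (hM : FramedRep.IsAbsolutelyIrreducible (FramedGaloisRep.restrictField M ρ))
    (L : Type) [Field L] [Algebra ℚ L] [IsCyclotomicExtension {5} ℚ L] :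
    FramedRep.IsAbsolutelyIrreducible (FramedGaloisRep.restrictField L ρ) :=
  absIrr_comp_of_forall_index_two_le ρ (absGaloisRestrict ℚ M)
    (absGaloisRestrict ℚ L) (range_absGaloisRestrict_cyclotomic_normal L)
    (range_cyclotomic_le_range_sqrt L M) (index_subgroupOf_range_sqrt_eq_two L M)
    (range_sqrt_le_of_index_two L M) hM

/-- **B1 as gen 3 / k2 H-A1 / k3 H2 stated it (KERNEL-CHECKED from the general form):** the stub's
hypothesis `ρ.IsAbsIrreducibleOverSqrt 5` gives absolute irreducibility over every model of `ℚ(ζ₅)`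
(instantiate at Mathlib's model `(X² - 5).SplittingField`, as in
`IsAbsIrreducibleOverSqrt.isAbsolutelyIrreducible`).  The binders `W`, `hρ` of gen 3 are NOT needed. -/
theorem isAbsIrr_restrict_cyclotomic_of_isAbsIrrOverSqrt_five (ρ : ModPGaloisRep ℚ (ZMod 5) 2)
    (h : ρ.IsAbsIrreducibleOverSqrt 5) (L : Type) [Field L] [Algebra ℚ L]
    [IsCyclotomicExtension {5} ℚ L] :
    FramedRep.IsAbsolutelyIrreducible (FramedGaloisRep.restrictField L ρ) :=
  @absIrr_restrictField_cyclotomic_of_sqrt_five _ _ _ ρ (X ^ 2 - C (5 : ℚ) : ℚ[X]).SplittingField _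
    (_) (IsSplittingField.splittingField _)
    (@h (X ^ 2 - C (5 : ℚ) : ℚ[X]).SplittingField _ (_) (IsSplittingField.splittingField _)) L _ _ _

/-- **B1' (packaging for FLS's hypothesis; S from B1).** All framed models of `E[5]` are conjugate,
and absolute irreducibility over `ℚ(√5)` is conjugation-invariant, so B1 for the stub's framing gives
`ModPImageAbsIrreducibleOverCyclotomic W 5` (all framings, all models of `ℚ(ζ₅)`). -/
theorem modPImageAbsIrreducibleOverCyclotomic_of_isAbsIrrOverSqrt_five (W : WeierstrassCurve ℚ)
    [W.IsElliptic] (ρ : ModPGaloisRep ℚ (ZMod 5) 2) (hρ : W.IsTorsionGaloisRep 5 ρ)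
    (h : ρ.IsAbsIrreducibleOverSqrt 5) : ModPImageAbsIrreducibleOverCyclotomic W 5 := by
  sorry

/-- **B4 (integral model; S).** Every elliptic `W/ℚ` is `ℚ`-isomorphic (clear denominators,
`u = 1/d`) to the base change of an integral model `E/𝓞 ℚ` with `Δ(E) ≠ 0`; stated in the exact form
the assembly consumes. -/
theorem exists_integralModel (W : WeierstrassCurve ℚ) [W.IsElliptic] :
    ∃ (E : WeierstrassCurve (𝓞 ℚ)) (C : WeierstrassCurve.VariableChange ℚ)
      (_ : (E.baseChange ℚ).IsElliptic), E.Δ ≠ 0 ∧ C • W = E.baseChange ℚ := by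
  sorry

/-- **B6 (GEN 4: CLOSED BY CITATION — zero cycles).** `IsModular (C • W) → IsModular W` is the
ACCEPTED tree theorem `Summit.ABC.ABC.Theorems.isModular_smul_iff`
(`Summits/ABC/ABC/Theorems/IsogenyGlueCongruenceSemistableModularDatum.lean`, l.155); with that
import the proof is `subst hCW; exact (Summit.ABC.ABC.Theorems.isModular_smul_iff W C).mp`.  Kept as
a `sorry` here only because this companion imports Literature only (the farm reports the summit-side
`IsogenyGlue…` modules `remote:stale…unbuilt` today). [cite: SilvermanAEC2009, App. C §16] -/
theorem isModular_of_smul_eq (W : WeierstrassCurve ℚ) [W.IsElliptic] [NeZero (W.conductorNorm ℤ)]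
    (C : WeierstrassCurve.VariableChange ℚ) (W' : WeierstrassCurve ℚ) [NeZero (W'.conductorNorm ℤ)]
    (hCW : C • W = W') : BCDT.IsModular W' → BCDT.IsModular W := by
  sorry

/-- **B3 (L — the ONE large debt of the FLS road, candidate NAMED FACT): "Carayol's way back",
adelic ⇒ classical over `ℚ`.** A weight-zero cuspidal `π` of `GL₂(𝔸_ℚ)` with Hecke polynomial
`X² − a_p(E) X + p` at every `p ∤ Δ(E)` (`IsAutomorphicOfWeightZero E`) yields the newform
`f ∈ S₂(Γ₀(N_E))` with `aₙ(f) = aₙ(E)` (`BCDT.IsModular`): newvector (Casselman 1973), `ρ_f`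
(`eichlerShimuraConstruction`, ALREADY a leaf of S9 `stub_threeImpTwo`), `ρ_f ≅ V_ℓ E` (Chebotarev +
Brauer–Nesbitt + Faltings), all Euler factors and `N_f = N_E` (Carayol 1986, Thm. (A) ⇒ Cor. 0.8). -/
def IsModularOfAutomorphicRat : Prop :=
  ∀ (E : WeierstrassCurve (𝓞 ℚ)) [(E.baseChange ℚ).IsElliptic]
    [NeZero ((E.baseChange ℚ).conductorNorm ℤ)],
    E.Δ ≠ 0 → IsAutomorphicOfWeightZero E → BCDT.IsModular (E.baseChange ℚ)

/-- **Closer B (KERNEL-CHECKED modulo B1', B4, with B3 as the hypothesis `hB3`):**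
`FLS2015_theorems3_4 → IsModularOfAutomorphicRat → LiftFive`.  The torsion transport along
`C • W = E ⊗ ℚ` is the tree's `MatarNekovar2019.isTorsionGaloisRep_smul`; `ρ.IsModular` and
`¬ 25 ∣ N_E` are not used. -/
theorem liftFive_of_FLS2015_theorems3_4 (h : FLS2015_theorems3_4) (hB3 : IsModularOfAutomorphicRat) :
    LiftFive := by
  intro W _ ρ hρ hirr _ _
  haveI : NeZero (W.conductorNorm ℤ) := ⟨(WeierstrassCurve.conductorNorm_pos_holds W).ne'⟩
  obtain ⟨E, C, _, hΔ, hCW⟩ := exists_integralModel W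
  haveI : NeZero ((E.baseChange ℚ).conductorNorm ℤ) :=
    ⟨(WeierstrassCurve.conductorNorm_pos_holds (E.baseChange ℚ)).ne'⟩
  have himgW : ModPImageAbsIrreducibleOverCyclotomic W 5 :=
    modPImageAbsIrreducibleOverCyclotomic_of_isAbsIrrOverSqrt_five W ρ hρ hirr
  have himgE : ModPImageAbsIrreducibleOverCyclotomic (E.baseChange ℚ) 5 := by
    intro ρ' hρ' L _ _ _
    have hW : W.IsTorsionGaloisRep 5 ρ' := by
      have h' := MatarNekovar2019.isTorsionGaloisRep_smul (E.baseChange ℚ) C⁻¹ hρ'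
      rwa [← hCW, inv_smul_smul] at h'
    exact himgW ρ' hW L
  have hE : IsAutomorphicOfWeightZero E := h ℚ E hΔ 5 (Or.inr (Or.inl rfl)) himgE
  exact (isModular_of_smul_eq W C (E.baseChange ℚ) hCW (hB3 E hΔ hE)).isModularGaloisRepTate 5

/-! ### GEN 4 · L3 — Frey curves have NO vexing primes (for the record of the `[W]`/`[TW]`-only
question): `q² ∤ N_{E_(a,b)}` for every odd prime `q`. -/

/-- **L3 (PROVED).** For coprime `a, b` with `ab(a+b) ≠ 0` and an odd prime `q`, `q² ∤ N_{E_(a,b)}`: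
`N ∣ 2⁸ · rad(ab(a+b))` (`conductorNorm_freyCurve_dvd_holds`) and the radical is squarefree.  In
particular no prime `q ≡ -1 (mod ℓ)` is vexing for `ρ̄_{E,ℓ}`, `ℓ` odd (type V needs `q² ∣ N`).
Same proof as the skeleton's `not_twentyFive_dvd_conductorNorm_freyCurve`.
[cite: BombieriGubler2006, Ex. 12.5.10] -/
theorem not_sq_dvd_conductorNorm_freyCurve_of_odd {a b : ℤ} (hab : IsCoprime a b)
    (h0 : a * b * (a + b) ≠ 0) {q : ℕ} (hq : q.Prime) (hq2 : q ≠ 2) :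
    ¬ q ^ 2 ∣ (freyCurve a b).conductorNorm ℤ := by
  intro hq2N
  have hdvd := conductorNorm_freyCurve_dvd_holds a b hab h0
  have h' : q ^ 2 ∣ 2 ^ 8 * (UniqueFactorizationMonoid.radical (a * b * (a + b))).natAbs :=
    hq2N.trans hdvd
  have hcop : Nat.Coprime (q ^ 2) (2 ^ 8) :=
    Nat.Coprime.pow _ _ ((Nat.coprime_primes hq Nat.prime_two).mpr hq2)
  have hr : q ^ 2 ∣ (UniqueFactorizationMonoid.radical (a * b * (a + b))).natAbs :=
    hcop.dvd_of_dvd_mul_left h'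
  have hsq : Squarefree (UniqueFactorizationMonoid.radical (a * b * (a + b))).natAbs :=
    Int.squarefree_natAbs.mpr UniqueFactorizationMonoid.squarefree_radical
  have hu : IsUnit (q : ℕ) := hsq q ((pow_two q) ▸ hr)
  exact hq.ne_one (Nat.isUnit_iff.mp hu)

end Summit.ABC.ABC.Cruxes.FreyModularity.StubIdeasLiftFive1

end
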